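import Summits.AtomisticToContinuum.HydrodynamicLimit.Theorems.ImplosionDichotomyPolynomialCompressionUniquenessEnergy
import Mathlib.Analysis.ODE.Gronwall
import Mathlib.Analysis.SpecialFunctions.Sqrt
import Mathlib.MeasureTheory.Integral.IntervalIntegral.FundThmCalculus

/-!
# Quantitative Grönwall / energy shell on the flat torus (with forcing)

Helper file for the line `log-lipschitz-budget` of the crux
`ImplosionDichotomy.PolynomialCompression` (stub `stub_logBudgetShadowing`). The zero-data shell
`torus_energy_eq_zero_of_balance` (file `…UniquenessEnergy`) turns a pointwise balance
`∂ₜe + Σᵢ ∂ᵢΦᵢ ≤ C e`, `e ≥ 0`, `e(0, ·) = 0` into `e ≡ 0`. Here we prove its QUANTITATIVE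
version with time-dependent coefficients and a forcing term: from

* the pointwise balance `∂ₜe + Σᵢ ∂ᵢΦᵢ ≤ Λ(t) e + r` on `[0, T) × 𝕋³` (`∂ₜ` one-sided within
  `[0, T)`),
* the forcing bound `∫ r(t, ·) ≤ G(t) √(∫ e(t, ·))`,
* `Λ, G ≥ 0` continuous on `[0, T)`,

we get, for the total energy `E(t) = ∫ e(t, x) dx`,

  `√E(t) ≤ exp(½ ∫₀ᵗ Λ) · (√E(0) + ½ ∫₀ᵗ G)`,  `t ∈ [0, T)`.

Proof: `E' = ∫ ∂ₜe = ∫ (∂ₜe + div Φ) ≤ Λ E + G √E` (divergence theorem on `𝕋³`, differentiation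
under `∫`); for `ε > 0` the regularised root `F_ε = √(E + ε²)` satisfies the LINEAR one-sided
differential inequality `F_ε' ≤ (Λ/2) F_ε + G/2`; a scalar Grönwall lemma with continuous
variable coefficients (`le_exp_integral_mul_of_deriv_right_le`, proved here from Mathlib's fencing
theorem `image_le_of_deriv_right_le_deriv_boundary` applied to
`H = exp(-∫Λ/2) F_ε - ∫ G/2`) gives the bound for `F_ε`, and `ε → 0`.
-/

noncomputable section

namespace Summit.AtomisticToContinuum.HydrodynamicLimit.Theorems

open Set Filter Topology MeasureTheory
open Literature.MathematicalPhysics.KineticTheory Literature.Analysis.FunctionSpaces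

/-! ### Scalar Grönwall with continuous variable coefficients (one-sided derivatives) -/

/-- FTC-1, one-sided: for `f` continuous on `[0, t]` and `s ∈ [0, t)`, the primitive
`u ↦ ∫₀ᵘ f` has right derivative `f s` at `s`. [folklore] -/
theorem hasDerivWithinAt_intervalIntegral_Ici {f : ℝ → ℝ} {t s : ℝ}
    (hf : ContinuousOn f (Icc 0 t)) (hs : s ∈ Ico 0 t) :
    HasDerivWithinAt (fun u => ∫ τ in (0:ℝ)..u, f τ) (f s) (Ici s) s := by
  have hint : IntervalIntegrable f volume 0 s := by
    refine (hf.mono ?_).intervalIntegrable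
    rw [uIcc_of_le hs.1]
    exact Icc_subset_Icc_right hs.2.le
  have hmem : Icc 0 t ∈ 𝓝[>] s :=
    mem_of_superset (Ioo_mem_nhdsGT hs.2) fun x hx => ⟨hs.1.trans hx.1.le, hx.2.le⟩
  have hmeas : StronglyMeasurableAtFilter f (𝓝[>] s) volume :=
    (hf.stronglyMeasurableAtFilter_nhdsWithin measurableSet_Icc s).filter_mono
      (nhdsWithin_le_of_mem hmem)
  have hcont : ContinuousWithinAt f (Ioi s) s :=
    (hf s ⟨hs.1, hs.2.le⟩).mono_of_mem_nhdsWithin hmem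
  exact intervalIntegral.integral_hasDerivWithinAt_right hint hmeas hcont

/-- **Scalar Grönwall inequality, variable continuous coefficients, one-sided form.** If `F` is
continuous on `[0, t]` with right derivative `F' s ≤ K s * F s + g s` at every `s ∈ [0, t)`,
where `K, g ≥ 0` are continuous on `[0, t]`, then
`F t ≤ exp(∫₀ᵗ K) * (F 0 + ∫₀ᵗ g)` (the function `exp(-∫₀ˢK) F s - ∫₀ˢ g` is non-increasing:
Mathlib's fencing theorem `image_le_of_deriv_right_le_deriv_boundary`). [folklore] -/
theorem le_exp_integral_mul_of_deriv_right_le {F F' K g : ℝ → ℝ} {t : ℝ} (ht : 0 ≤ t)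
    (hcont : ContinuousOn F (Icc 0 t))
    (hderiv : ∀ s ∈ Ico 0 t, HasDerivWithinAt F (F' s) (Ici s) s)
    (hK : ContinuousOn K (Icc 0 t)) (hg : ContinuousOn g (Icc 0 t))
    (hK0 : ∀ s ∈ Icc 0 t, 0 ≤ K s) (hg0 : ∀ s ∈ Icc 0 t, 0 ≤ g s)
    (hbound : ∀ s ∈ Ico 0 t, F' s ≤ K s * F s + g s) :
    F t ≤ Real.exp (∫ s in (0:ℝ)..t, K s) * (F 0 + ∫ s in (0:ℝ)..t, g s) := by
  set A : ℝ → ℝ := fun u => ∫ s in (0:ℝ)..u, K s with hA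
  set B : ℝ → ℝ := fun u => ∫ s in (0:ℝ)..u, g s with hB
  -- continuity of the primitives on `[0, t]`
  have hAc : ContinuousOn A (Icc 0 t) := by
    have h := intervalIntegral.continuousOn_primitive_interval (μ := volume) (f := K) (a := 0)
      (b := t) (by rw [uIcc_of_le ht]; exact hK.integrableOn_Icc)
    rwa [uIcc_of_le ht] at h
  have hBc : ContinuousOn B (Icc 0 t) := by
    have h := intervalIntegral.continuousOn_primitive_interval (μ := volume) (f := g) (a := 0)
      (b := t) (by rw [uIcc_of_le ht]; exact hg.integrableOn_Icc)
    rwa [uIcc_of_le ht] at h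
  -- the comparison function `H = exp(-A) F - B` and its right derivative
  set H : ℝ → ℝ := fun u => Real.exp (-A u) * F u - B u with hH
  have hHc : ContinuousOn H (Icc 0 t) :=
    ((Real.continuous_exp.comp_continuousOn hAc.neg).mul hcont).sub hBc
  have hHd : ∀ s ∈ Ico 0 t, HasDerivWithinAt H
      (Real.exp (-A s) * -K s * F s + Real.exp (-A s) * F' s - g s) (Ici s) s := by
    intro s hs
    have hA' : HasDerivWithinAt A (K s) (Ici s) s := hasDerivWithinAt_intervalIntegral_Ici hK hs
    have hB' : HasDerivWithinAt B (g s) (Ici s) s := hasDerivWithinAt_intervalIntegral_Ici hg hs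
    exact ((hA'.neg.exp).mul (hderiv s hs)).sub hB'
  have hHbound : ∀ s ∈ Ico 0 t,
      Real.exp (-A s) * -K s * F s + Real.exp (-A s) * F' s - g s ≤ 0 := by
    intro s hs
    have hAs : 0 ≤ A s :=
      intervalIntegral.integral_nonneg hs.1 fun u hu => hK0 u ⟨hu.1, hu.2.trans hs.2.le⟩
    have hexp1 : Real.exp (-A s) ≤ 1 := Real.exp_le_one_iff.2 (by linarith)
    have hexp0 : 0 < Real.exp (-A s) := Real.exp_pos _
    have h1 : Real.exp (-A s) * (F' s - K s * F s) ≤ Real.exp (-A s) * g s :=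
      mul_le_mul_of_nonneg_left (by linarith [hbound s hs]) hexp0.le
    have h2 : Real.exp (-A s) * g s ≤ g s :=
      mul_le_of_le_one_left (hg0 s (Ico_subset_Icc_self hs)) hexp1
    nlinarith [h1, h2]
  -- fencing: `H t ≤ H 0 = F 0`
  have hHt : H t ≤ H 0 :=
    image_le_of_deriv_right_le_deriv_boundary hHc hHd (B := fun _ => H 0) (B' := fun _ => 0)
      le_rfl continuousOn_const (fun _ _ => hasDerivWithinAt_const _ _ _) hHbound
      (right_mem_Icc.2 ht)
  have hH0 : H 0 = F 0 := by simp [hH, hA, hB]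
  have hkey : Real.exp (-A t) * F t ≤ F 0 + B t := by
    have h := hHt
    rw [hH0] at h
    simp only [hH] at h
    linarith
  calc F t = Real.exp (A t) * (Real.exp (-A t) * F t) := by
        rw [← mul_assoc, ← Real.exp_add, add_neg_cancel, Real.exp_zero, one_mul]
    _ ≤ Real.exp (A t) * (F 0 + B t) := mul_le_mul_of_nonneg_left hkey (Real.exp_pos _).le

/-! ### The quantitative energy shell on `[0, T) × 𝕋³` -/

/-- **Energy method on the torus, quantitative shell with forcing.** Let `e ≥ 0` (energy density),
`r` (forcing density) and `Φ₀, Φ₁, Φ₂` (fluxes) be jointly smooth scalar fields on `[0, T) × 𝕋³`,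
`Λ, G ≥ 0` continuous on `[0, T)`, with the pointwise balance `∂ₜe + Σᵢ ∂ᵢΦᵢ ≤ Λ(t) e + r`
(`∂ₜ` one-sided within `[0, T)`) and the forcing bound `∫ r(t, ·) ≤ G(t) √(∫ e(t, ·))`. Then the
total energy `E(t) = ∫ e(t, x) dx` obeys
`√E(t) ≤ exp(½∫₀ᵗ Λ) (√E(0) + ½∫₀ᵗ G)` for every `t ∈ [0, T)`: `E' = ∫ (∂ₜe + Σᵢ∂ᵢΦᵢ) ≤ Λ E + G√E`
(divergence theorem, differentiation under `∫`), the regularised root `√(E + ε²)` satisfies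
`F' ≤ (Λ/2) F + G/2`, Grönwall (`le_exp_integral_mul_of_deriv_right_le`), and `ε → 0`. [folklore] -/
theorem torus_energy_le_of_balance :
    ∀ {T : ℝ} {e r : ℝ → T3 → ℝ} {Φ : Fin 3 → ℝ → T3 → ℝ} {Λ G : ℝ → ℝ},
      Torus.IsSmoothSpaceTimeOn (Ico 0 T) e → Torus.IsSmoothSpaceTimeOn (Ico 0 T) r →
      (∀ i, Torus.IsSmoothSpaceTimeOn (Ico 0 T) (Φ i)) →
      (∀ t ∈ Ico 0 T, ∀ x, 0 ≤ e t x) →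
      ContinuousOn Λ (Ico 0 T) → ContinuousOn G (Ico 0 T) →
      (∀ t ∈ Ico 0 T, 0 ≤ Λ t) → (∀ t ∈ Ico 0 T, 0 ≤ G t) →
      (∀ t ∈ Ico 0 T, ∀ x,
        Torus.timeDerivWithin (Ico 0 T) e t x + ∑ i, Torus.partialDeriv i (Φ i t) x ≤
          Λ t * e t x + r t x) →
      (∀ t ∈ Ico 0 T, ∫ x, r t x ≤ G t * Real.sqrt (∫ x, e t x)) →
      ∀ t ∈ Ico 0 T, Real.sqrt (∫ x, e t x) ≤
        Real.exp ((∫ s in (0:ℝ)..t, Λ s) / 2) *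
          (Real.sqrt (∫ x, e 0 x) + (∫ s in (0:ℝ)..t, G s) / 2) := by
  intro T e r Φ Λ G he hr hΦ hnonneg hΛ hG hΛ0 hG0 hbal hrG t ht
  have hU : UniqueDiffOn ℝ (Ico (0 : ℝ) T) := uniqueDiffOn_Ico 0 T
  have h0T : (0 : ℝ) ∈ Ico 0 T := ⟨le_rfl, ht.1.trans_lt ht.2⟩
  have hIcc : Icc 0 t ⊆ Ico 0 T := Icc_subset_Ico_right ht.2
  -- the total energy, its one-sided derivative, and the differential inequality
  set E : ℝ → ℝ := fun s => ∫ x, e s x with hE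
  set E' : ℝ → ℝ := fun s => ∫ x, Torus.timeDerivWithin (Ico 0 T) e s x with hE'
  have hderiv : ∀ s ∈ Ico 0 T, HasDerivWithinAt E (E' s) (Ico 0 T) s :=
    fun s hs => he.hasDerivWithinAt_integral (convex_Ico 0 T) hs
  have hEnonneg : ∀ s ∈ Ico 0 T, 0 ≤ E s := fun s hs => integral_nonneg fun x => hnonneg s hs x
  have hflux : ∀ s ∈ Ico 0 T, ∫ x, ∑ i, Torus.partialDeriv i (Φ i s) x = 0 := by
    intro s hs
    rw [integral_finsetSum _ fun i _ => (((hΦ i).isSmooth_slice hs).partialDeriv i).integrable]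
    exact Finset.sum_eq_zero fun i _ =>
      Torus.integral_partialDeriv_eq_zero_holds ((hΦ i).isSmooth_slice hs) i
  have hle : ∀ s ∈ Ico 0 T, E' s ≤ Λ s * E s + G s * Real.sqrt (E s) := by
    intro s hs
    have hi1 : Integrable (Torus.timeDerivWithin (Ico 0 T) e s) volume :=
      (he.isSmooth_timeDerivWithin hU hs).integrable
    have hi2 : Integrable (fun x => ∑ i, Torus.partialDeriv i (Φ i s) x) volume :=
      integrable_finsetSum _ fun i _ => (((hΦ i).isSmooth_slice hs).partialDeriv i).integrable
    have hi3 : Integrable (fun x => Λ s * e s x) volume :=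
      ((he.isSmooth_slice hs).integrable).const_mul (Λ s)
    have hi4 : Integrable (r s) volume := (hr.isSmooth_slice hs).integrable
    calc E' s
        = ∫ x, (Torus.timeDerivWithin (Ico 0 T) e s x + ∑ i, Torus.partialDeriv i (Φ i s) x) := by
          rw [integral_add hi1 hi2, hflux s hs, add_zero]
      _ ≤ ∫ x, (Λ s * e s x + r s x) :=
          integral_mono (hi1.add hi2) (hi3.add hi4) fun x => hbal s hs x
      _ = Λ s * E s + ∫ x, r s x := by rw [integral_add hi3 hi4, integral_const_mul]
      _ ≤ Λ s * E s + G s * Real.sqrt (E s) := by linarith [hrG s hs]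
  -- reduction to an `ε`-regularised bound
  set a : ℝ := (∫ s in (0:ℝ)..t, Λ s) / 2 with ha
  set b : ℝ := (∫ s in (0:ℝ)..t, G s) / 2 with hb
  suffices key : ∀ ε : ℝ, 0 < ε → Real.sqrt (E t) ≤ Real.exp a * (Real.sqrt (E 0) + ε + b) by
    refine le_of_forall_pos_le_add fun δ hδ => ?_
    have hexp : Real.exp a ≠ 0 := (Real.exp_pos a).ne'
    calc Real.sqrt (E t) ≤ Real.exp a * (Real.sqrt (E 0) + δ / Real.exp a + b) :=
          key (δ / Real.exp a) (div_pos hδ (Real.exp_pos a))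
      _ = Real.exp a * (Real.sqrt (E 0) + b) + δ := by field_simp; ring
  intro ε hε
  -- the regularised root `F = √(E + ε²)` and its one-sided derivative
  have hpos : ∀ s ∈ Ico 0 T, 0 < E s + ε ^ 2 := fun s hs =>
    add_pos_of_nonneg_of_pos (hEnonneg s hs) (pow_pos hε 2)
  set F : ℝ → ℝ := fun s => Real.sqrt (E s + ε ^ 2) with hF
  set F' : ℝ → ℝ := fun s => E' s / (2 * Real.sqrt (E s + ε ^ 2)) with hF'
  have hFderiv : ∀ s ∈ Ico 0 T, HasDerivWithinAt F (F' s) (Ico 0 T) s := fun s hs =>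
    ((hderiv s hs).add_const (ε ^ 2)).sqrt (hpos s hs).ne'
  have hFcont : ContinuousOn F (Icc 0 t) := fun s hs =>
    ((hFderiv s (hIcc hs)).continuousWithinAt).mono hIcc
  have hFright : ∀ s ∈ Ico 0 t, HasDerivWithinAt F (F' s) (Ici s) s := by
    intro s hs
    have hsT : s ∈ Ico 0 T := ⟨hs.1, hs.2.trans ht.2⟩
    exact (hFderiv s hsT).mono_of_mem_nhdsWithin
      (Filter.mem_of_superset (Ico_mem_nhdsGE hsT.2) (Ico_subset_Ico_left hsT.1))
  -- the linear differential inequality `F' ≤ (Λ/2) F + G/2`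
  have hFbound : ∀ s ∈ Ico 0 t, F' s ≤ Λ s / 2 * F s + G s / 2 := by
    intro s hs
    have hsT : s ∈ Ico 0 T := ⟨hs.1, hs.2.trans ht.2⟩
    have hFs : 0 < F s := Real.sqrt_pos.2 (hpos s hsT)
    have hF2 : F s ^ 2 = E s + ε ^ 2 := Real.sq_sqrt (hpos s hsT).le
    have hEF : E s ≤ F s ^ 2 := by rw [hF2]; nlinarith
    have hsqEF : Real.sqrt (E s) ≤ F s := Real.sqrt_le_sqrt (by nlinarith)
    have h1 : E' s ≤ Λ s * F s ^ 2 + G s * F s :=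
      (hle s hsT).trans (add_le_add (mul_le_mul_of_nonneg_left hEF (hΛ0 s hsT))
        (mul_le_mul_of_nonneg_left hsqEF (hG0 s hsT)))
    have h2 : F' s = E' s / (2 * F s) := rfl
    rw [h2, div_le_iff₀ (by positivity)]
    nlinarith [h1]
  -- Grönwall for `F`
  have hmain : F t ≤ Real.exp (∫ s in (0:ℝ)..t, Λ s / 2) * (F 0 + ∫ s in (0:ℝ)..t, G s / 2) :=
    le_exp_integral_mul_of_deriv_right_le (K := fun s => Λ s / 2) (g := fun s => G s / 2) ht.1
      hFcont hFright ((hΛ.mono hIcc).div_const 2) ((hG.mono hIcc).div_const 2)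
      (fun s hs => div_nonneg (hΛ0 s (hIcc hs)) zero_le_two)
      (fun s hs => div_nonneg (hG0 s (hIcc hs)) zero_le_two) hFbound
  rw [intervalIntegral.integral_div, intervalIntegral.integral_div] at hmain
  -- `ε`-bookkeeping: `√E(t) ≤ F t`, `F 0 ≤ √E(0) + ε`
  have hEt : Real.sqrt (E t) ≤ F t := Real.sqrt_le_sqrt (by nlinarith)
  have hF0 : F 0 ≤ Real.sqrt (E 0) + ε := by
    refine Real.sqrt_le_iff.2 ⟨by positivity, ?_⟩
    nlinarith [Real.sq_sqrt (hEnonneg 0 h0T), Real.sqrt_nonneg (E 0), hε.le]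
  calc Real.sqrt (E t) ≤ F t := hEt
    _ ≤ Real.exp a * (F 0 + b) := hmain
    _ ≤ Real.exp a * (Real.sqrt (E 0) + ε + b) :=
        mul_le_mul_of_nonneg_left (by linarith) (Real.exp_pos a).le

end Summit.AtomisticToContinuum.HydrodynamicLimit.Theorems

end
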